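import Summits.ABC.IUTFork.Conditional.AbcExpOfSigmaMassMu
import HarnessLib

/-!
# R-H ROUND 2 EXPONENT PROGRAMME (rh-lead RULING R18, 2026-08-27T01:12:36Z), piece F5 — THE UNIFORM LABEL CUT, MASS SIDE: at the bed of a genuine
# datum `S(l⋆)·mass(Σ^{(J)}) = S(min(J,l⋆))·T.gap`, so the relative tolerance [MU] HOLDS on `Σ^{(J)} = {j ≤ J}` as an identity of label arithmetic;
# the half cut `J = ⌈l⋆/2⌉` keeps `≥ 1/8` of `S(l⋆)` at every admissible `l`

PROOF-ONLY file (0 definitions, 0 `Prop` facts, no instance, no notation) of the abc-iut cell, rung LADDER-ABC:A2.RESCUE.H; seat abc-iut-rh2-T-1 (gen 2,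
«GO rh2-T-1 EXP-END»). R18 (adopting rh2-ref-3's pre-finding (A)–(D)): F5's showcase instance is NOT `σ := Σ_data` (there [MU-C] is a height ceiling,
near-circular in substance) but the UNIFORM LABEL CUT `σ := Σ^{(J)} :=` «every cell with label `j ≤ J` at every place» (datum-free): on it [MU] is
DISCHARGED AS AN IDENTITY — `mass(Σ^{(J)})/M = S(min(J,l⋆))/S(l⋆)`, `S(n) = n(n−1)(2n+5)/6` (abc-iut-rh2-w-1's `mass_labelSegment_eq`) — and [LIC-C on
`Σ^{(J)}`] is GENUINE licence content (`Σ^{(J)} ∖ Σ_data` = the unlicensed high-label mass a round-3 object must supply; «drive `J/l⋆ → 1`»). The half cut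
`J = ⌈l⋆/2⌉` keeps `μ₀(1/2) = 1/8` of `S(l⋆)` at every admissible `l` (rh2-ref-3 01:16:33Z: true for all `l⋆ ≥ 3` except `l⋆ = 4`, i.e. `l = 9`, not
prime) ⟹ exponent currency `8` (`24` in the degree-one currency of the companion `AbcExpOfSigmaMassLabelCutDegOne.lean`; `ABCWithExponent 8` /
the far-from-cusps family in the endpoint `AbcExpOfSigmaMassContent.lean` once F1/F3/F4 land).

COMPOSED BY NAME (nothing re-typed): this seat's `offSigmaTolerance_offTrivialMass_chosen_iff` (p482365), `SigmaMass.tol` / `tol_nonneg` (p477154), `RH.SigmaMass.onTrivialMass` / `totalTrivialMass` / `totalTrivialMass_nonneg` (p477034);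
abc-iut-rh2-w-1's `RH.CellWeights.mass_labelSegment_eq`, `totalMass_eq_finsum_placeSum` (p477616), `qLocal_settingPrVolSharp_labelIndep` (p477159),
`cellTrivialCost_settingPrVolSharp_eq_pilotGapWeight`, `onTrivialMass_settingPrVolSharp_eq_mass`, `totalTrivialMass_chosen_eq_gap` (p478601); abc-iut-rh2-xi-1's
`OffSigmaTolerance` (p469145).

WHAT IS TYPED (`l⋆ = (l−1)/2`; `S(n) = n(n−1)(2n+5)/6` written out; `Σ^{(J)} = {c | c.1 + 1 ≤ J}`; bed = sharp setting at `pilotDataOfK T.D T.K`, chosen ideles):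
* §1 `sqSubOneSum_mul_onTrivialMass_labelCut_chosen_eq` (**`S(l⋆)·mass(Σ^{(J)}) = S(min(J,l⋆))·T.gap`**), `sqSubOneSum_lstar_pos`,
  `mu_mul_gap_le_onTrivialMass_labelCut_chosen` (`μ₀·S(l⋆) ≤ S(min(J,l⋆)) ⟹ μ₀·T.gap ≤ mass(Σ^{(J)})`), **`offSigmaTolerance_labelCut_chosen`** (same ⟹
  `OffSigmaTolerance (1−μ₀) (Tol(P,l)) T (B_triv(Σ^{(J)}ᶜ))`: [MU-C] HOLDS on the label cut).
* §2 `sqSubOneSum_lstar_le_eight_mul_half` (**`l` prime `≥ 7 ⟹ S(l⋆) ≤ 8·S(⌈l⋆/2⌉)`**; closed forms `8·S(m) − S(2m) = m(2m−5)`, `8·S(m+1) − S(2m+1) = m(6m+7)`;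
  `l⋆ = 4 ⟺ l ∈ {9, 10}` excluded by primality), `eighth_mul_sqSubOneSum_lstar_le_half`.
* The display-level showcase ([LIC-C on `Σ^{(J)}`]·[CONE-C] ⟹ the `S(l⋆)/S(J)`-dilated display; half cut ⟹ factor `8`) is the companion
  `Conditional/AbcExpOfSigmaMassLabelCut.lean`; the degree-one / `ABCWithExponent` endpoints follow it.
HONEST FRAMING: CONDITIONAL; «follows from these hypotheses AS TYPED», nothing more; [LIC-C on `Σ^{(J)}`] / [CONE-C] are ASSUMPTION LABELS, never asserted
— on the tabulated genuine bed the licence FAILS above `j₀(v) < ⌈l⋆/2⌉` at every deep place (MIN-SLICE (iii), SLICE.md), and NO tabulated datum lies on the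
content locus; nothing here asserts that abc is proved or refuted or that [IUTchIII] Cor. 3.12 / [IUTchIV] Thm. 1.10 holds or fails anywhere; no side taken
on any author; typed ≠ proved; instantiated ≠ endorsed. [cite: Mochizuki2012, IUTchIII Cor. 3.12 p. 173–174, Step (xi-f) p. 184; IUTchIV Thm. 1.10
pp. 22–31 (Step (v) pp. 27–29), Cor. 2.2 (ii) p. 46] [cite: DupuyHilado2025, §3.3, §3.9] [claim: Mochizuki2012, status: disputed] for every IUT locution.
Axioms: standard.
-/

noncomputable section

open Set Function NumberField IsDedekindDomain

namespace Summit.ABC.IUTFork.Conditional.SigmaMass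

open Summit.ABC.IUTFork.Thm311 Summit.ABC.IUTFork.Thm311.Real Summit.ABC.IUTFork.Cor312 Summit.ABC.IUTFork.Cor312.Setting
  Summit.ABC.IUTFork.Cor312Vol Summit.ABC.IUTFork.Cor312Prov Literature.IUT.LogThetaLattice Literature.IUT.LogVolume
  Literature.IUT.HodgeTheaters Literature.IUT.LogVolume.ThetaData
  Literature.NumberTheory.DiophantineGeometry.GenEll Summit.ABC.ABC.Theorems
  Summit.ABC.IUTFork.Repair.RH.SigmaLicence Summit.ABC.IUTFork.Repair.RH.SigmaStrataEq Summit.ABC.IUTFork.Repair.RH.SigmaMass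
  Summit.ABC.IUTFork.Repair.RH.OffSigma Summit.ABC.IUTFork.Conditional

/-! ## §1 AT THE BED OF A GENUINE DATUM (chosen ideles): the mass of the UNIFORM LABEL CUT `Σ^{(J)} = {j ≤ J}` is `S(min(J,l⋆))/S(l⋆)` of `T.gap` -/

/-- **`S(l⋆)·mass(Σ^{(J)}) = S(min(J, l⋆))·T.gap` — [MU] DISCHARGED AS AN IDENTITY ON THE UNIFORM LABEL CUT (rh-lead R18).** At the bed of a genuine
Θ-volume datum `T` of `(P, l)` (abc-iut-c312-7's sharp setting at `pilotDataOfK T.D T.K`, CHOSEN realising ideles, ANY context), for the stratum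
`Σ^{(J)} := {(i, v_ℚ) | j = i+1 ≤ J}` («every cell with label `≤ J` at EVERY place» — datum-free): `S(l⋆)·mass(Σ^{(J)}) = S(min(J, l⋆))·T.gap`,
`S(n) = n(n−1)(2n+5)/6`, `l⋆ = (l−1)/2` — abc-iut-rh2-w-1's `RH.CellWeights.mass_labelSegment_eq` / `totalMass_eq_finsum_placeSum` (p477616) with the
label-independence of the q-volume at the bed (`qLocal_settingPrVolSharp_labelIndep`, p477159) and `totalTrivialMass = T.gap` (p478601); both sides are
`S(·)·(Σᶠ_v h_v)/l⋆`. [cite: Mochizuki2012, IUTchIII Cor. 3.12 p. 173–174; IUTchIV Thm. 1.10 Step (v) p. 27–29] [claim: Mochizuki2012, status: disputed] -/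
theorem sqSubOneSum_mul_onTrivialMass_labelCut_chosen_eq {P : NFPoint} {l : ℕ} (T : Cor22.ThetaVolumeDatumAt P l) (J : ℕ) :
    letI := T.instFieldF; letI := T.instNumberFieldF; letI := T.instAlgebraF; letI := T.instFieldK;
        letI := T.instNumberFieldK; letI := T.instAlgebraK; letI := T.instFieldFbar; letI := T.instAlgebraFbar;
        letI := T.instAlgebraKFbar; letI := T.instIsElliptic;
    ∀ (M : Type) [Field M] [NumberField M]
      (archPk : ∀ (j : (thetaIndex (pilotDataOfK T.D T.K)).Label) (vQ : (thetaIndex (pilotDataOfK T.D T.K)).VQ),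
        Set ((logShellsDH (pilotDataOfK T.D T.K) (analyticLogv T.K)).Packet j vQ))
      (archSub : ∀ (j : (thetaIndex (pilotDataOfK T.D T.K)).Label) (v : (thetaIndex (pilotDataOfK T.D T.K)).V),
        Set ((logShellsDH (pilotDataOfK T.D T.K) (analyticLogv T.K)).Packet j ((thetaIndex (pilotDataOfK T.D T.K)).over v)))
      (Ψ : ℤ → ∀ v : (thetaIndex (pilotDataOfK T.D T.K)).V, v ∈ (thetaIndex (pilotDataOfK T.D T.K)).Vbad →
        Set ((logShellsDH (pilotDataOfK T.D T.K) (analyticLogv T.K)).StarPacket v))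
      (act : ℤ → ∀ v : (thetaIndex (pilotDataOfK T.D T.K)).V, v ∈ (thetaIndex (pilotDataOfK T.D T.K)).Vbad →
        (logShellsDH (pilotDataOfK T.D T.K) (analyticLogv T.K)).StarPacket v →
          Module.End ℚ ((logShellsDH (pilotDataOfK T.D T.K) (analyticLogv T.K)).StarPacket v))
      (Mmod : ℤ → ∀ j : (thetaIndex (pilotDataOfK T.D T.K)).LabelStar,
        Set ((logShellsDH (pilotDataOfK T.D T.K) (analyticLogv T.K)).GlobalPacket j.1))
      (region : ℤ → ∀ j : (thetaIndex (pilotDataOfK T.D T.K)).LabelStar, FinDivisor M →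
        ∀ vQ : (thetaIndex (pilotDataOfK T.D T.K)).VQ, Set ((logShellsDH (pilotDataOfK T.D T.K) (analyticLogv T.K)).Packet j.1 vQ))
      (n : ℤ) {HT : Type} {LogLink : HT → HT → Type} {IsFull : ∀ {s t : HT}, LogLink s t → Prop}
      (lat : LGPGaussianLogThetaLattice LogLink IsFull)
      {Frd : Type} {IsoF : Frd → Frd → Type} {Ob : Frd → Type} {realify : Frd → Frd} {Strip : Type}
      {IsoS : Strip → Strip → Type}
      {Mv : ∀ v : (thetaIndex (pilotDataOfK T.D T.K)).V, v ∈ (thetaIndex (pilotDataOfK T.D T.K)).Vbad → Type}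
      [∀ v h, Monoid (Mv v h)]
      (sig : GlobalLGPFrobenioidSignature (thetaIndex (pilotDataOfK T.D T.K)).lstar (thetaIndex (pilotDataOfK T.D T.K)).V
        (· ∈ (thetaIndex (pilotDataOfK T.D T.K)).Vbad) Frd IsoF Ob realify Strip IsoS Mv)
      (split : SplittingMonoids Mv) {ObΔ : Type}
      {N : ∀ v : (thetaIndex (pilotDataOfK T.D T.K)).V, v ∈ (thetaIndex (pilotDataOfK T.D T.K)).Vbad → Type} [∀ v h, Monoid (N v h)]
      (qData : QPilotData ObΔ N),
      ((((l - 1) / 2 : ℕ) : ℝ) * ((((l - 1) / 2 : ℕ) : ℝ) - 1) * (2 * (((l - 1) / 2 : ℕ) : ℝ) + 5) / 6) *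
          onTrivialMass
            (settingPrVolSharp (pilotDataOfK T.D T.K) (logvAnalytic_analyticLogv (F := T.K)) M archPk archSub Ψ act Mmod region n lat
            sig split qData (exists_realising_qIdeles_pilotDataOfK T.D).choose (exists_realising_thetaIdeles_pilotDataOfK T.D).choose
            (exists_realising_qIdeles_pilotDataOfK T.D).choose_spec.1 (exists_realising_qIdeles_pilotDataOfK T.D).choose_spec.2.1)
            {c | (c.1 : ℕ) + 1 ≤ J} =
        (((min J ((l - 1) / 2) : ℕ) : ℝ) * (((min J ((l - 1) / 2) : ℕ) : ℝ) - 1) * (2 * ((min J ((l - 1) / 2) : ℕ) : ℝ) + 5) / 6) * T.gap := by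
  intro M _ _ archPk archSub Ψ act Mmod region n HT LogLink IsFull lat Frd IsoF Ob realify Strip IsoS Mv _ sig split ObΔ N _ qData
  letI := T.instFieldF; letI := T.instNumberFieldF; letI := T.instAlgebraF; letI := T.instFieldK
  letI := T.instNumberFieldK; letI := T.instAlgebraK; letI := T.instFieldFbar; letI := T.instAlgebraFbar
  letI := T.instAlgebraKFbar; letI := T.instIsElliptic
  have hls : (thetaIndex (pilotDataOfK T.D T.K)).lstar = (l - 1) / 2 := rfl
  have h5 : 5 ≤ l := T.D.five_le_l
  have hl0 : 0 < (thetaIndex (pilotDataOfK T.D T.K)).lstar := by rw [hls]; omega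
  -- the q-volume is label-independent at the bed (abc-iut-rh2-w-1)
  have hq : ∀ (i : Fin (thetaIndex (pilotDataOfK T.D T.K)).lstar) (vQ : (thetaIndex (pilotDataOfK T.D T.K)).VQ),
      (settingPrVolSharp (pilotDataOfK T.D T.K) (logvAnalytic_analyticLogv (F := T.K)) M archPk archSub Ψ act Mmod region n lat
            sig split qData (exists_realising_qIdeles_pilotDataOfK T.D).choose (exists_realising_thetaIdeles_pilotDataOfK T.D).choose
            (exists_realising_qIdeles_pilotDataOfK T.D).choose_spec.1 (exists_realising_qIdeles_pilotDataOfK T.D).choose_spec.2.1).qLocal (labelSucc i) vQ =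
      (settingPrVolSharp (pilotDataOfK T.D T.K) (logvAnalytic_analyticLogv (F := T.K)) M archPk archSub Ψ act Mmod region n lat
            sig split qData (exists_realising_qIdeles_pilotDataOfK T.D).choose (exists_realising_thetaIdeles_pilotDataOfK T.D).choose
            (exists_realising_qIdeles_pilotDataOfK T.D).choose_spec.1 (exists_realising_qIdeles_pilotDataOfK T.D).choose_spec.2.1).qLocal (labelSucc ⟨0, hl0⟩) vQ :=
    fun i vQ => Repair.RH.CellWeights.qLocal_settingPrVolSharp_labelIndep (pilotDataOfK T.D T.K) (logvAnalytic_analyticLogv (F := T.K))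
      M archPk archSub Ψ act Mmod region n lat sig split qData (exists_realising_qIdeles_pilotDataOfK T.D).choose (exists_realising_thetaIdeles_pilotDataOfK T.D).choose
      (exists_realising_qIdeles_pilotDataOfK T.D).choose_spec.1 (exists_realising_qIdeles_pilotDataOfK T.D).choose_spec.2.1
      (exists_realising_qIdeles_pilotDataOfK T.D).choose_spec.2.2 i ⟨0, hl0⟩ vQ
  -- the label cut is an initial segment `j ≤ min(J, l⋆)` at EVERY packet
  have hmass := Repair.RH.CellWeights.mass_labelSegment_eq
    (settingPrVolSharp (pilotDataOfK T.D T.K) (logvAnalytic_analyticLogv (F := T.K)) M archPk archSub Ψ act Mmod region n lat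
            sig split qData (exists_realising_qIdeles_pilotDataOfK T.D).choose (exists_realising_thetaIdeles_pilotDataOfK T.D).choose
            (exists_realising_qIdeles_pilotDataOfK T.D).choose_spec.1 (exists_realising_qIdeles_pilotDataOfK T.D).choose_spec.2.1) hq
    (j₀ := fun _ => min J ((l - 1) / 2)) (fun _ => by rw [hls]; exact min_le_right _ _) {c | (c.1 : ℕ) + 1 ≤ J}
    (fun i vQ => by
      have hi : (i : ℕ) < (l - 1) / 2 := hls ▸ i.2
      simp only [Set.mem_setOf_eq, le_min_iff]
      exact ⟨fun h => ⟨h, by omega⟩, fun h => h.1⟩)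
  have htot := Repair.RH.CellWeights.totalMass_eq_finsum_placeSum
    (settingPrVolSharp (pilotDataOfK T.D T.K) (logvAnalytic_analyticLogv (F := T.K)) M archPk archSub Ψ act Mmod region n lat
            sig split qData (exists_realising_qIdeles_pilotDataOfK T.D).choose (exists_realising_thetaIdeles_pilotDataOfK T.D).choose
            (exists_realising_qIdeles_pilotDataOfK T.D).choose_spec.1 (exists_realising_qIdeles_pilotDataOfK T.D).choose_spec.2.1) hq
  have hM : totalTrivialMass (settingPrVolSharp (pilotDataOfK T.D T.K) (logvAnalytic_analyticLogv (F := T.K)) M archPk archSub Ψ act Mmod region n lat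
            sig split qData (exists_realising_qIdeles_pilotDataOfK T.D).choose (exists_realising_thetaIdeles_pilotDataOfK T.D).choose
            (exists_realising_qIdeles_pilotDataOfK T.D).choose_spec.1 (exists_realising_qIdeles_pilotDataOfK T.D).choose_spec.2.1) = T.gap :=
    Repair.RH.CellWeights.totalTrivialMass_chosen_eq_gap T M archPk archSub Ψ act Mmod region n lat sig split qData
  rw [← hM, Repair.RH.CellWeights.onTrivialMass_settingPrVolSharp_eq_mass (pilotDataOfK T.D T.K) (logvAnalytic_analyticLogv (F := T.K))
      M archPk archSub Ψ act Mmod region n lat sig split qData (exists_realising_qIdeles_pilotDataOfK T.D).choose (exists_realising_thetaIdeles_pilotDataOfK T.D).choose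
      (exists_realising_qIdeles_pilotDataOfK T.D).choose_spec.1 (exists_realising_qIdeles_pilotDataOfK T.D).choose_spec.2.1
      (exists_realising_thetaIdeles_pilotDataOfK T.D).choose_spec.1 (exists_realising_thetaIdeles_pilotDataOfK T.D).choose_spec.2.2
      (exists_realising_qIdeles_pilotDataOfK T.D).choose_spec.2.2,
    hmass]
  unfold totalTrivialMass
  rw [Repair.RH.CellWeights.cellTrivialCost_settingPrVolSharp_eq_pilotGapWeight (pilotDataOfK T.D T.K) (logvAnalytic_analyticLogv (F := T.K))
      M archPk archSub Ψ act Mmod region n lat sig split qData (exists_realising_qIdeles_pilotDataOfK T.D).choose (exists_realising_thetaIdeles_pilotDataOfK T.D).choose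
      (exists_realising_qIdeles_pilotDataOfK T.D).choose_spec.1 (exists_realising_qIdeles_pilotDataOfK T.D).choose_spec.2.1
      (exists_realising_thetaIdeles_pilotDataOfK T.D).choose_spec.1 (exists_realising_thetaIdeles_pilotDataOfK T.D).choose_spec.2.2
      (exists_realising_qIdeles_pilotDataOfK T.D).choose_spec.2.2]
  have hlsR : (((thetaIndex (pilotDataOfK T.D T.K)).lstar : ℕ) : ℝ) = (((l - 1) / 2 : ℕ) : ℝ) := congrArg Nat.cast hls
  rw [htot, ← mul_finsum, ← mul_finsum, hlsR]
  ring

/-- `S(l⋆) = l⋆(l⋆−1)(2l⋆+5)/6 > 0` for `l ≥ 5` (`l⋆ = (l−1)/2 ≥ 2`). [folklore] -/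
theorem sqSubOneSum_lstar_pos {l : ℕ} (h5 : 5 ≤ l) : 0 < ((((l - 1) / 2 : ℕ) : ℝ) * ((((l - 1) / 2 : ℕ) : ℝ) - 1) * (2 * (((l - 1) / 2 : ℕ) : ℝ) + 5) / 6) := by
  have h2 : 2 ≤ (l - 1) / 2 := by omega
  have h2R : (2 : ℝ) ≤ (((l - 1) / 2 : ℕ) : ℝ) := by exact_mod_cast h2
  have ha : (0 : ℝ) < (((l - 1) / 2 : ℕ) : ℝ) := by linarith
  have hb : (0 : ℝ) < (((l - 1) / 2 : ℕ) : ℝ) - 1 := by linarith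
  have hc : (0 : ℝ) < 2 * (((l - 1) / 2 : ℕ) : ℝ) + 5 := by linarith
  positivity

/-- **THE LABEL CUT SUPPLIES THE SHARE `μ₀ = S(min(J,l⋆))/S(l⋆)` OF THE GAP**: at the bed of a genuine datum with the chosen ideles, if
`μ₀·S(l⋆) ≤ S(min(J, l⋆))` (pure label arithmetic) then `μ₀·T.gap ≤ mass(Σ^{(J)})` (`T.gap ≥ 0` as a total trivial mass; `S(l⋆) > 0`).
[claim: Mochizuki2012, status: disputed] -/
theorem mu_mul_gap_le_onTrivialMass_labelCut_chosen {P : NFPoint} {l : ℕ} (T : Cor22.ThetaVolumeDatumAt P l) {μ₀ : ℝ} (J : ℕ)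
    (hJ : μ₀ * ((((l - 1) / 2 : ℕ) : ℝ) * ((((l - 1) / 2 : ℕ) : ℝ) - 1) * (2 * (((l - 1) / 2 : ℕ) : ℝ) + 5) / 6) ≤
      (((min J ((l - 1) / 2) : ℕ) : ℝ) * (((min J ((l - 1) / 2) : ℕ) : ℝ) - 1) * (2 * ((min J ((l - 1) / 2) : ℕ) : ℝ) + 5) / 6)) :
    letI := T.instFieldF; letI := T.instNumberFieldF; letI := T.instAlgebraF; letI := T.instFieldK;
        letI := T.instNumberFieldK; letI := T.instAlgebraK; letI := T.instFieldFbar; letI := T.instAlgebraFbar;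
        letI := T.instAlgebraKFbar; letI := T.instIsElliptic;
    ∀ (M : Type) [Field M] [NumberField M]
      (archPk : ∀ (j : (thetaIndex (pilotDataOfK T.D T.K)).Label) (vQ : (thetaIndex (pilotDataOfK T.D T.K)).VQ),
        Set ((logShellsDH (pilotDataOfK T.D T.K) (analyticLogv T.K)).Packet j vQ))
      (archSub : ∀ (j : (thetaIndex (pilotDataOfK T.D T.K)).Label) (v : (thetaIndex (pilotDataOfK T.D T.K)).V),
        Set ((logShellsDH (pilotDataOfK T.D T.K) (analyticLogv T.K)).Packet j ((thetaIndex (pilotDataOfK T.D T.K)).over v)))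
      (Ψ : ℤ → ∀ v : (thetaIndex (pilotDataOfK T.D T.K)).V, v ∈ (thetaIndex (pilotDataOfK T.D T.K)).Vbad →
        Set ((logShellsDH (pilotDataOfK T.D T.K) (analyticLogv T.K)).StarPacket v))
      (act : ℤ → ∀ v : (thetaIndex (pilotDataOfK T.D T.K)).V, v ∈ (thetaIndex (pilotDataOfK T.D T.K)).Vbad →
        (logShellsDH (pilotDataOfK T.D T.K) (analyticLogv T.K)).StarPacket v →
          Module.End ℚ ((logShellsDH (pilotDataOfK T.D T.K) (analyticLogv T.K)).StarPacket v))
      (Mmod : ℤ → ∀ j : (thetaIndex (pilotDataOfK T.D T.K)).LabelStar,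
        Set ((logShellsDH (pilotDataOfK T.D T.K) (analyticLogv T.K)).GlobalPacket j.1))
      (region : ℤ → ∀ j : (thetaIndex (pilotDataOfK T.D T.K)).LabelStar, FinDivisor M →
        ∀ vQ : (thetaIndex (pilotDataOfK T.D T.K)).VQ, Set ((logShellsDH (pilotDataOfK T.D T.K) (analyticLogv T.K)).Packet j.1 vQ))
      (n : ℤ) {HT : Type} {LogLink : HT → HT → Type} {IsFull : ∀ {s t : HT}, LogLink s t → Prop}
      (lat : LGPGaussianLogThetaLattice LogLink IsFull)
      {Frd : Type} {IsoF : Frd → Frd → Type} {Ob : Frd → Type} {realify : Frd → Frd} {Strip : Type}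
      {IsoS : Strip → Strip → Type}
      {Mv : ∀ v : (thetaIndex (pilotDataOfK T.D T.K)).V, v ∈ (thetaIndex (pilotDataOfK T.D T.K)).Vbad → Type}
      [∀ v h, Monoid (Mv v h)]
      (sig : GlobalLGPFrobenioidSignature (thetaIndex (pilotDataOfK T.D T.K)).lstar (thetaIndex (pilotDataOfK T.D T.K)).V
        (· ∈ (thetaIndex (pilotDataOfK T.D T.K)).Vbad) Frd IsoF Ob realify Strip IsoS Mv)
      (split : SplittingMonoids Mv) {ObΔ : Type}
      {N : ∀ v : (thetaIndex (pilotDataOfK T.D T.K)).V, v ∈ (thetaIndex (pilotDataOfK T.D T.K)).Vbad → Type} [∀ v h, Monoid (N v h)]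
      (qData : QPilotData ObΔ N),
      μ₀ * T.gap ≤
        onTrivialMass
          (settingPrVolSharp (pilotDataOfK T.D T.K) (logvAnalytic_analyticLogv (F := T.K)) M archPk archSub Ψ act Mmod region n lat
            sig split qData (exists_realising_qIdeles_pilotDataOfK T.D).choose (exists_realising_thetaIdeles_pilotDataOfK T.D).choose
            (exists_realising_qIdeles_pilotDataOfK T.D).choose_spec.1 (exists_realising_qIdeles_pilotDataOfK T.D).choose_spec.2.1)
          {c | (c.1 : ℕ) + 1 ≤ J} := by
  intro M _ _ archPk archSub Ψ act Mmod region n HT LogLink IsFull lat Frd IsoF Ob realify Strip IsoS Mv _ sig split ObΔ N _ qData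
  letI := T.instFieldF; letI := T.instNumberFieldF; letI := T.instAlgebraF; letI := T.instFieldK
  letI := T.instNumberFieldK; letI := T.instAlgebraK; letI := T.instFieldFbar; letI := T.instAlgebraFbar
  letI := T.instAlgebraKFbar; letI := T.instIsElliptic
  have e := sqSubOneSum_mul_onTrivialMass_labelCut_chosen_eq T J M archPk archSub Ψ act Mmod region n lat sig split qData
  have hS := sqSubOneSum_lstar_pos (l := l) T.D.five_le_l
  have hgap : 0 ≤ T.gap := by
    rw [← Repair.RH.CellWeights.totalTrivialMass_chosen_eq_gap T M archPk archSub Ψ act Mmod region n lat sig split qData]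
    exact totalTrivialMass_nonneg
  have h1 := mul_le_mul_of_nonneg_right hJ hgap
  refine le_of_mul_le_mul_left ?_ hS
  rw [e]
  linarith

/-- **[MU] DISCHARGED ON THE LABEL CUT**: at the bed with the chosen ideles, `μ₀·S(l⋆) ≤ S(min(J, l⋆))` ⟹
`OffSigmaTolerance (1−μ₀) (Tol(P,l)) T (B_triv(Σ^{(J)}ᶜ))` — the relative-tolerance hypothesis [MU-C] of `displayWith_pointwise_of_licenceOn_mu_content_hregC`
(p482104) HOLDS for `σ := Σ^{(J)}` as an identity of label arithmetic (`offSigmaTolerance_offTrivialMass_chosen_iff`, p482365; `Tol ≥ 0`): on the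
label cut ONLY [LIC-C] and [CONE-C] remain hypotheses. [claim: Mochizuki2012, status: disputed] -/
theorem offSigmaTolerance_labelCut_chosen {P : NFPoint} {l : ℕ} (T : Cor22.ThetaVolumeDatumAt P l) {μ₀ : ℝ} (J : ℕ)
    (hJ : μ₀ * ((((l - 1) / 2 : ℕ) : ℝ) * ((((l - 1) / 2 : ℕ) : ℝ) - 1) * (2 * (((l - 1) / 2 : ℕ) : ℝ) + 5) / 6) ≤
      (((min J ((l - 1) / 2) : ℕ) : ℝ) * (((min J ((l - 1) / 2) : ℕ) : ℝ) - 1) * (2 * ((min J ((l - 1) / 2) : ℕ) : ℝ) + 5) / 6)) :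
    letI := T.instFieldF; letI := T.instNumberFieldF; letI := T.instAlgebraF; letI := T.instFieldK;
        letI := T.instNumberFieldK; letI := T.instAlgebraK; letI := T.instFieldFbar; letI := T.instAlgebraFbar;
        letI := T.instAlgebraKFbar; letI := T.instIsElliptic;
    ∀ (M : Type) [Field M] [NumberField M]
      (archPk : ∀ (j : (thetaIndex (pilotDataOfK T.D T.K)).Label) (vQ : (thetaIndex (pilotDataOfK T.D T.K)).VQ),
        Set ((logShellsDH (pilotDataOfK T.D T.K) (analyticLogv T.K)).Packet j vQ))
      (archSub : ∀ (j : (thetaIndex (pilotDataOfK T.D T.K)).Label) (v : (thetaIndex (pilotDataOfK T.D T.K)).V),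
        Set ((logShellsDH (pilotDataOfK T.D T.K) (analyticLogv T.K)).Packet j ((thetaIndex (pilotDataOfK T.D T.K)).over v)))
      (Ψ : ℤ → ∀ v : (thetaIndex (pilotDataOfK T.D T.K)).V, v ∈ (thetaIndex (pilotDataOfK T.D T.K)).Vbad →
        Set ((logShellsDH (pilotDataOfK T.D T.K) (analyticLogv T.K)).StarPacket v))
      (act : ℤ → ∀ v : (thetaIndex (pilotDataOfK T.D T.K)).V, v ∈ (thetaIndex (pilotDataOfK T.D T.K)).Vbad →
        (logShellsDH (pilotDataOfK T.D T.K) (analyticLogv T.K)).StarPacket v →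
          Module.End ℚ ((logShellsDH (pilotDataOfK T.D T.K) (analyticLogv T.K)).StarPacket v))
      (Mmod : ℤ → ∀ j : (thetaIndex (pilotDataOfK T.D T.K)).LabelStar,
        Set ((logShellsDH (pilotDataOfK T.D T.K) (analyticLogv T.K)).GlobalPacket j.1))
      (region : ℤ → ∀ j : (thetaIndex (pilotDataOfK T.D T.K)).LabelStar, FinDivisor M →
        ∀ vQ : (thetaIndex (pilotDataOfK T.D T.K)).VQ, Set ((logShellsDH (pilotDataOfK T.D T.K) (analyticLogv T.K)).Packet j.1 vQ))
      (n : ℤ) {HT : Type} {LogLink : HT → HT → Type} {IsFull : ∀ {s t : HT}, LogLink s t → Prop}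
      (lat : LGPGaussianLogThetaLattice LogLink IsFull)
      {Frd : Type} {IsoF : Frd → Frd → Type} {Ob : Frd → Type} {realify : Frd → Frd} {Strip : Type}
      {IsoS : Strip → Strip → Type}
      {Mv : ∀ v : (thetaIndex (pilotDataOfK T.D T.K)).V, v ∈ (thetaIndex (pilotDataOfK T.D T.K)).Vbad → Type}
      [∀ v h, Monoid (Mv v h)]
      (sig : GlobalLGPFrobenioidSignature (thetaIndex (pilotDataOfK T.D T.K)).lstar (thetaIndex (pilotDataOfK T.D T.K)).V
        (· ∈ (thetaIndex (pilotDataOfK T.D T.K)).Vbad) Frd IsoF Ob realify Strip IsoS Mv)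
      (split : SplittingMonoids Mv) {ObΔ : Type}
      {N : ∀ v : (thetaIndex (pilotDataOfK T.D T.K)).V, v ∈ (thetaIndex (pilotDataOfK T.D T.K)).Vbad → Type} [∀ v h, Monoid (N v h)]
      (qData : QPilotData ObΔ N),
      OffSigmaTolerance (1 - μ₀) (tol P l) T
        (offTrivialMass
          (settingPrVolSharp (pilotDataOfK T.D T.K) (logvAnalytic_analyticLogv (F := T.K)) M archPk archSub Ψ act Mmod region n lat
            sig split qData (exists_realising_qIdeles_pilotDataOfK T.D).choose (exists_realising_thetaIdeles_pilotDataOfK T.D).choose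
            (exists_realising_qIdeles_pilotDataOfK T.D).choose_spec.1 (exists_realising_qIdeles_pilotDataOfK T.D).choose_spec.2.1)
          {c | (c.1 : ℕ) + 1 ≤ J}) := by
  intro M _ _ archPk archSub Ψ act Mmod region n HT LogLink IsFull lat Frd IsoF Ob realify Strip IsoS Mv _ sig split ObΔ N _ qData
  letI := T.instFieldF; letI := T.instNumberFieldF; letI := T.instAlgebraF; letI := T.instFieldK
  letI := T.instNumberFieldK; letI := T.instAlgebraK; letI := T.instFieldFbar; letI := T.instAlgebraFbar
  letI := T.instAlgebraKFbar; letI := T.instIsElliptic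
  have h := mu_mul_gap_le_onTrivialMass_labelCut_chosen T J hJ M archPk archSub Ψ act Mmod region n lat sig split qData
  have ht : 0 ≤ tol P l := tol_nonneg
  exact (offSigmaTolerance_offTrivialMass_chosen_iff T μ₀ M archPk archSub Ψ act Mmod region n lat sig split qData {c | (c.1 : ℕ) + 1 ≤ J}).2 (by linarith)

/-! ## §2 LABEL ARITHMETIC: the lower HALF of the labels keeps `≥ 1/8` of `S(l⋆)` at every admissible `l` (`l` prime `≥ 7`; rh2-ref-3 01:16:33Z) -/

/-- **`S(l⋆) ≤ 8·S(⌈l⋆/2⌉)` for `l` prime `≥ 7`** (`l⋆ = (l−1)/2`, `⌈l⋆/2⌉ = (l⋆+1)/2`, `S(n) = n(n−1)(2n+5)/6`): `8·S(m) − S(2m) = m(2m−5) ≥ 0` for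
`m ≥ 3` and `8·S(m+1) − S(2m+1) = m(6m+7) ≥ 0`; the one failing value `l⋆ = 4` (`S(2)/S(4) = 3/26 < 1/8`, rh2-ref-3's exact scan `n ≤ 3000`) is
`l = 9`, not prime. So the UNIFORM HALF CUT keeps the share `μ₀(1/2) = 1/8` of the `j²`-mass at every admissible `l` (infimum `1/8⁺` as `l → ∞`;
`3/11` at `l = 7`). [folklore] -/
theorem sqSubOneSum_lstar_le_eight_mul_half {l : ℕ} (hl : l.Prime) (h7 : 7 ≤ l) :
    ((((l - 1) / 2 : ℕ) : ℝ) * ((((l - 1) / 2 : ℕ) : ℝ) - 1) * (2 * (((l - 1) / 2 : ℕ) : ℝ) + 5) / 6) ≤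
      8 * (((((l - 1) / 2 + 1) / 2 : ℕ) : ℝ) * (((((l - 1) / 2 + 1) / 2 : ℕ) : ℝ) - 1) * (2 * ((((l - 1) / 2 + 1) / 2 : ℕ) : ℝ) + 5) / 6) := by
  obtain ⟨k, hk | hk⟩ := Nat.even_or_odd' ((l - 1) / 2)
  · -- `l⋆ = 2k`, `⌈l⋆/2⌉ = k`, and `k ≥ 3` because `l⋆ = 4` would force `l ∈ {9, 10}`
    have hm : ((l - 1) / 2 + 1) / 2 = k := by omega
    have hk3 : 3 ≤ k := by
      by_contra h
      have h910 : l = 9 ∨ l = 10 := by omega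
      rcases h910 with rfl | rfl <;> norm_num at hl
    rw [hm, hk]
    push_cast
    have hk3R : (3 : ℝ) ≤ k := by exact_mod_cast hk3
    have hnn : (0 : ℝ) ≤ (k : ℝ) * (2 * k - 5) := mul_nonneg (by linarith) (by linarith)
    nlinarith [hnn]
  · -- `l⋆ = 2k+1`, `⌈l⋆/2⌉ = k+1`
    have hm : ((l - 1) / 2 + 1) / 2 = k + 1 := by omega
    rw [hm, hk]
    push_cast
    have hk0 : (0 : ℝ) ≤ k := Nat.cast_nonneg k
    have hnn : (0 : ℝ) ≤ (k : ℝ) * (6 * k + 7) := by positivity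
    nlinarith [hnn]

/-- The same bound in the shape consumed below: `(1/8)·S(l⋆) ≤ S(min(⌈l⋆/2⌉, l⋆))` for `l` prime `≥ 7`. [folklore] -/
theorem eighth_mul_sqSubOneSum_lstar_le_half {l : ℕ} (hl : l.Prime) (h7 : 7 ≤ l) :
    1 / 8 * ((((l - 1) / 2 : ℕ) : ℝ) * ((((l - 1) / 2 : ℕ) : ℝ) - 1) * (2 * (((l - 1) / 2 : ℕ) : ℝ) + 5) / 6) ≤
      (((min (((l - 1) / 2 + 1) / 2) ((l - 1) / 2) : ℕ) : ℝ) * (((min (((l - 1) / 2 + 1) / 2) ((l - 1) / 2) : ℕ) : ℝ) - 1) * (2 * ((min (((l - 1) / 2 + 1) / 2) ((l - 1) / 2) : ℕ) : ℝ) + 5) / 6) := by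
  rw [Nat.min_eq_left (by omega : ((l - 1) / 2 + 1) / 2 ≤ (l - 1) / 2)]
  have h := sqSubOneSum_lstar_le_eight_mul_half hl h7
  linarith

end Summit.ABC.IUTFork.Conditional.SigmaMass

end
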